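import Summits.CriticalPhenomena.PercolationContinuityZ3.Theses.PercPorousCritical
import Summits.CriticalPhenomena.PercolationContinuityZ3.Theses.PercDebrisSweep
import Summits.CriticalPhenomena.PercolationContinuityZ3.Statement
import Literature.Probability.Percolation.KestenZhangTailProofs
import Literature.Probability.Percolation.CriticalTwoArmsPersistence
import HarnessLib

/-!
# Position of the crux `FiniteClusterVolumeTail` (K, stmt-CriticalPhenomena-0943) over the tree

K (shared crux of the routes PercPorousCritical / PercDebrisSweep / PercQuarantineIslands / PercFoamCut of
the sub-problem `PercolationContinuityZ3`): for every `p` with `θ(p) > 0` there is `c > 0` with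
`P_p(m ≤ |C(0)| < ∞) ≤ exp(-c m^{2/3})` for all `m ≥ 1` — Kesten–Zhang's surface-order law AT THE SAME
DENSITY. This file records, kernel-checked and without any hypothesis beyond the tree, WHERE K sits:

* `finiteClusterVolumeTail_iff_criticalInstance` — **K is equivalent to its own `p_c`-instance**: since
  `θ(p) > 0` forces `p = p_c ∨ p > p_c` and the `p > p_c` half is the tree theorem
  `Grimmett1999_thm_8_65_holds.z3` (Kesten–Zhang 1990 = Grimmett 1999 Thm. (8.65), sorry-free in
  `Literature/Probability/Percolation/KestenZhangTailProofs.lean`), the whole content of K is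
  "IF `θ(p_c) > 0` THEN finite clusters at `p_c` have surface-order tails".
* `finiteClusterVolumeTail_of_percolationContinuityZ3` — **the summit conjunct implies K**
  (`θ(p_c) = 0` makes the `p_c`-instance vacuous). Hence `¬K` is unreachable short of `¬PercolationContinuityZ3`
  (`not_percolationContinuityZ3_of_not_finiteClusterVolumeTail`): no refuter can kill this crux without
  disproving the conjecture, and every route of the form `K ∧ X ⇒ PercolationContinuityZ3` proves exactly
  `X ⇒ (K ↔ PercolationContinuityZ3)`.
* `finiteClusterVolumeTail_or_jump` — **dichotomy**: either K holds, or we are in the jump world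
  `θ(p_c) > 0` where, by van den Berg–van Engelenburg's same-density renormalisation
  (`KestenZhang.exists_le_real_TwoArms_of_theta_pos`, `CriticalTwoArmsPersistence.lean`), Kesten–Zhang's
  clause (b) fails with probability `≥ ε` at EVERY large scale — the input of every block-renormalisation
  proof of K is then false, which is why the crux's only line (`Cruxes/FiniteClusterVolumeTail/Lines/birth.lean`)
  is dead: its load-bearing stub is `PercolationContinuityZ3` itself
  (`Literature.Barriers.CriticalPhenomena.twoArmsSmallOfTheta_iff_percolationContinuityZ3`).

No new definitions; all statements are over the route decls and `Literature.Probability.Percolation`.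
-/

noncomputable section

namespace Summit.CriticalPhenomena.PercolationContinuityZ3.Theorems.FiniteClusterVolumeTail

open MeasureTheory Literature.Probability.Percolation Literature.Probability.LatticeModels
open Summit.CriticalPhenomena.PercolationContinuityZ3.Theses.PercPorousCritical (FiniteClusterVolumeTail)

/-- The two route copies of K (`PercDebrisSweep`, `PercPorousCritical`) are the same proposition. -/
theorem percDebrisSweep_finiteClusterVolumeTail_iff :
    Theses.PercDebrisSweep.FiniteClusterVolumeTail ↔ FiniteClusterVolumeTail :=
  Iff.rfl

/-- **K is equivalent to its `p_c`-instance.** The `p > p_c` half of K is Kesten–Zhang 1990 =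
Grimmett 1999 Thm. (8.65), a theorem of the tree (`Grimmett1999_thm_8_65_holds.z3`); what remains is
the statement at a hypothetical percolating `p_c`. -/
theorem finiteClusterVolumeTail_iff_criticalInstance :
    FiniteClusterVolumeTail ↔
      (0 < theta (zdGraph 3) (0 : Site 3) (criticalProbI 3) →
        ∃ c : ℝ, 0 < c ∧ ∀ m : ℕ, 1 ≤ m →
          (bondPercolation (zdGraph 3) (criticalProbI 3)).real
              {ω | (m : ℕ∞) ≤ (openCluster ω 0).encard ∧ (openCluster ω 0).Finite} ≤
            Real.exp (-(c * (m : ℝ) ^ ((2 : ℝ) / 3)))) := by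
  constructor
  · exact fun h hθ => h _ hθ
  · intro h p hθ
    -- regime split `p = p_c ∨ p_c < p` (`p_c = inf {p | θ(p) > 0}`, Grimmett 1999 (1.11)); the named
    -- lemma `TruncatedSusceptibilityFiniteOfTheta.eq_criticalProbI_or_criticalProb_lt` lives in a heavy module
    rcases (KestenZhang.criticalProb_le_of_theta_pos_zd hθ).eq_or_lt with heq | hlt
    · obtain rfl : p = criticalProbI 3 := Subtype.ext (by rw [coe_criticalProbI]; exact heq.symm)
      exact h hθ
    · exact Grimmett1999_thm_8_65_holds.z3 p hlt

/-- **The summit conjunct implies K**: if `θ(p_c(ℤ³)) = 0` then every percolating `p` is strictly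
supercritical and K is Kesten–Zhang's theorem. So K is CONSISTENT relative to `PercolationContinuityZ3`
and cannot be refuted short of refuting the conjecture. -/
theorem finiteClusterVolumeTail_of_percolationContinuityZ3 (h : _root_.PercolationContinuityZ3) :
    FiniteClusterVolumeTail :=
  finiteClusterVolumeTail_iff_criticalInstance.mpr fun hθ =>
    absurd (percolationContinuityZ3_iff.mp h) hθ.ne'

/-- Contrapositive, for refuters: a disproof of K is a disproof of `θ(p_c(ℤ³)) = 0`. -/
theorem not_percolationContinuityZ3_of_not_finiteClusterVolumeTail (h : ¬ FiniteClusterVolumeTail) :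
    ¬ _root_.PercolationContinuityZ3 :=
  fun hs => h (finiteClusterVolumeTail_of_percolationContinuityZ3 hs)

/-- **Dichotomy.** Either K holds, or `θ(p_c) > 0` and Kesten–Zhang's clause (b) (`TwoArms N₀`: two
vertices of the core `B(3N₀+1)` joined inside `B̃ = B(5N₀+2)` to `∂B̃` but not to each other inside `B̃`)
keeps probability `≥ ε` at every scale `N₀ ≥ N₁` (van den Berg–van Engelenburg at the same density,
`KestenZhang.exists_le_real_TwoArms_of_theta_pos`) — in which case the input
`P_{p_c}(badAtOrigin N₀) ≤ 3136^{-125}` of the tree's `p`-blind Peierls engine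
`KestenZhang.real_tailEvent_le_exp` fails at every large scale. -/
theorem finiteClusterVolumeTail_or_jump :
    FiniteClusterVolumeTail ∨
      (0 < theta (zdGraph 3) (0 : Site 3) (criticalProbI 3) ∧
        ∃ ε : ℝ, 0 < ε ∧ ∃ N₁ : ℕ, ∀ N₀ : ℕ, N₁ ≤ N₀ →
          ε ≤ (bondPercolation (zdGraph 3) (criticalProbI 3)).real (KestenZhang.TwoArms (d := 3) N₀)) := by
  by_cases h : theta (zdGraph 3) (0 : Site 3) (criticalProbI 3) = 0
  · exact Or.inl (finiteClusterVolumeTail_of_percolationContinuityZ3 (percolationContinuityZ3_iff.mpr h))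
  · have hθ : 0 < theta (zdGraph 3) (0 : Site 3) (criticalProbI 3) :=
      lt_of_le_of_ne measureReal_nonneg (Ne.symm h)
    exact Or.inr ⟨hθ, KestenZhang.exists_le_real_TwoArms_of_theta_pos (d := 3) (by norm_num) hθ⟩

/-- **K in the jump world is the whole crux, and there the registered line's stub is false.** If
`θ(p_c) > 0` then "clause (b) small at large scales at `p_c`" fails, although K might still hold:
K does not pass through local uniqueness, the line does. -/
theorem not_twoArmsSmall_criticalProbI_of_theta_pos
    (hθ : 0 < theta (zdGraph 3) (0 : Site 3) (criticalProbI 3)) :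
    ¬ (∀ ε : ℝ, 0 < ε → ∃ N₁ : ℕ, ∀ N₀ : ℕ, N₁ ≤ N₀ →
        (bondPercolation (zdGraph 3) (criticalProbI 3)).real (KestenZhang.TwoArms (d := 3) N₀) ≤ ε) := by
  intro hsmall
  obtain ⟨ε, hε, N₁, hN₁⟩ := KestenZhang.exists_le_real_TwoArms_of_theta_pos (d := 3) (by norm_num) hθ
  obtain ⟨N₂, hN₂⟩ := hsmall (ε / 2) (half_pos hε)
  have h1 := hN₁ (max N₁ N₂) (le_max_left _ _)
  have h2 := hN₂ (max N₁ N₂) (le_max_right _ _)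
  linarith

end Summit.CriticalPhenomena.PercolationContinuityZ3.Theorems.FiniteClusterVolumeTail

end
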